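import Summits.Parity.GeneralizedHardyLittlewood.Theorems.GreenTaoLevelTwoMNTwoAlmostLinear
import Summits.Parity.GeneralizedHardyLittlewood.Theorems.GreenTaoLevelTwoMNTwoAlmostLinearThreeTerm

/-!
# Route `GreenTaoLevelTwo`, crux `MNTwo` (stmt-Parity-21276), line `birth`, stub `stub_mnVertical`:
# Möbius vs. almost linear phases, THREE-TERM form, assembled (GT 2008b Prop. 15)

Block V2/V6 of the `stub_mnVertical` census (B. Green, T. Tao, *Quadratic uniformity of the
Möbius function*, Ann. Inst. Fourier 58 (2008) = arXiv:math/0606087, §6 Proposition 15 and §12).  The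
companion of `…MNTwoAlmostLinear.norm_sum_moebius_almost_linear_le` with the approximate-linearity
hypothesis on a region replaced by the THREE-TERM bound actually consumed by the proof:
`‖φ(n) − φ(n+h₁+h₂) + φ(nₛ+h₁) + φ(nₛ+h₂) − 2φ(nₛ)‖ ≤ ε` for `n ≡ nₛ (mod q)` in `supp ψ` and
shifts `h₁, h₂ ∈ H`.  In §12 this is what the major-arc estimate `‖qφ''(h,h')‖ ≲ ‖h‖_g‖h'‖_g`
delivers for the shift set `H = q·B_g(0, ε/q)` (local bilinearity in the `H`-slot only).  Summing
`…MNTwoAlmostLinearThreeTerm.norm_sum_class_le_of_three_term` over the `q` residue classes with the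
Davenport input in `ℤ/10Nℤ`.  Def-free.

* `norm_sum_moebius_almost_linear_le_of_three_term` — for every `A > 0` there is `C ≥ 0` with
  `‖Σ_{N<n≤2N} μ(n)ψ(n)e(−φ(n))‖ ≤ C q/√δ · N/log^A N + 2πε Σψ + Σ_{(N,2N]} w`.

References: [GreenTao2008QuadraticMobius] arXiv:math/0606087 §6, Proposition 15.
-/

noncomputable section

open Finset Real ArithmeticFunction
open scoped ArithmeticFunction.Moebius

namespace Summit.Parity.GeneralizedHardyLittlewood.GreenTaoLevelTwoMNTwoAlmostLinearThreeTermSum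

open Summit.Parity.GeneralizedHardyLittlewood.GreenTaoLevelTwoMNTwoMoebiusTransfer
  (norm_sum_moebius_block_progression_le)
open Summit.Parity.GeneralizedHardyLittlewood.GreenTaoLevelTwoMNTwoAlmostLinearThreeTerm
  (norm_sum_class_le_of_three_term)
open Summit.Parity.GeneralizedHardyLittlewood.GreenTaoLevelTwoMNTwoAlmostLinear
  (sum_Ioc_eq_sum_mod_sum_filter)

/-! ### Proposition 15, three-term form -/

/-- **Möbius vs. almost linear phases, three-term form (GT 2008b Prop. 15 / §12).**  For every
`A > 0` there is `C ≥ 0` such that: for `N ≥ 2`, `q ≥ 1`, a finite set of admissible shifts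
`H ∋ 0` (`|h| ≤ N`, `q ∣ h`, `#H ≥ δN`), a weight `0 ≤ ψ ≤ 1` supported in `(N, 2N]` with shift
bound `|ψ(n+h₁+h₂) − ψ(n)| ≤ w(n)` (`h₁, h₂ ∈ H`, `w ≥ 0`), `ε ≥ 0`, and a phase `φ : ℤ → ℝ/ℤ` with
the three-term bound `‖φ(n) − φ(n+h₁+h₂) + φ(nₛ+h₁) + φ(nₛ+h₂) − 2φ(nₛ)‖ ≤ ε` whenever
`ψ(n), ψ(nₛ) ≠ 0`, `q ∣ n − nₛ`, `h₁, h₂ ∈ H`: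
`‖Σ_{N<n≤2N} μ(n) ψ(n) e(−φ(n))‖ ≤ C q/√δ · N/log^A N + 2πε Σ ψ + Σ_{(N,2N]} w`.
[cite: GreenTao2008QuadraticMobius, Proposition 15] -/
theorem norm_sum_moebius_almost_linear_le_of_three_term {A : ℝ} (hA : 0 < A) :
    ∃ C : ℝ, 0 ≤ C ∧ ∀ N : ℕ, 2 ≤ N → ∀ q : ℕ, 1 ≤ q → ∀ (H : Finset ℤ) (δ : ℝ), 0 < δ →
      δ * N ≤ #H → (0 : ℤ) ∈ H → (∀ h ∈ H, |h| ≤ N ∧ (q : ℤ) ∣ h) →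
      ∀ (ψ w : ℤ → ℝ) (φ : ℤ → UnitAddCircle) (ε : ℝ), 0 ≤ ε →
      (∀ n, 0 ≤ ψ n) → (∀ n, ψ n ≤ 1) → (∀ n, ψ n ≠ 0 → (N : ℤ) < n ∧ n ≤ 2 * N) →
      (∀ n, 0 ≤ w n) → (∀ n, ∀ h₁ ∈ H, ∀ h₂ ∈ H, |ψ (n + h₁ + h₂) - ψ n| ≤ w n) →
      (∀ n nₛ : ℤ, ψ n ≠ 0 → ψ nₛ ≠ 0 → (q : ℤ) ∣ n - nₛ → ∀ h₁ ∈ H, ∀ h₂ ∈ H,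
        ‖φ n - φ (n + h₁ + h₂) + φ (nₛ + h₁) + φ (nₛ + h₂) - 2 • φ nₛ‖ ≤ ε) →
      ‖∑ n ∈ Ioc N (2 * N),
          ((μ n : ℝ) : ℂ) * ((ψ n : ℝ) : ℂ) * ((AddCircle.toCircle (-φ n) : Circle) : ℂ)‖ ≤
        C * q / Real.sqrt δ * N / Real.log N ^ A +
          2 * Real.pi * ε * ∑ n ∈ Ioc N (2 * N), ψ n + ∑ n ∈ Ioc N (2 * N), w n := by
  obtain ⟨C₀, hC₀⟩ := norm_sum_moebius_block_progression_le hA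
  refine ⟨Real.sqrt 10 * max C₀ 0, by positivity, ?_⟩
  intro N hN q hq H δ hδ hδH h0H hH ψ w φ ε hε hψ0 hψ1 hsupp hw0 hw h3
  classical
  have hN1 : 1 ≤ N := by omega
  have hNpos : (0 : ℝ) < N := by exact_mod_cast (by omega : 0 < N)
  have hlog : 0 < Real.log N := Real.log_pos (by exact_mod_cast (by omega : 1 < N))
  have hLA : 0 < Real.log N ^ A := Real.rpow_pos_of_pos hlog A
  haveI : NeZero (10 * N) := ⟨by omega⟩
  set D : ℝ := max C₀ 0 * N / Real.log N ^ A with hDdef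
  have hD0 : 0 ≤ D := by positivity
  have hD : ∀ r : ℕ, ∀ ξ : ZMod (10 * N),
      ‖∑ n ∈ (Ioc N (2 * N)).filter (fun n : ℕ => n % q = r),
        ((μ n : ℝ) : ℂ) * (ZMod.stdAddChar ((n : ZMod (10 * N)) * ξ) : ℂ)‖ ≤ D := by
    intro r ξ
    refine (hC₀ N hN (10 * N) q hq r ξ).trans ?_
    rw [hDdef, div_le_div_iff_of_pos_right hLA]
    exact mul_le_mul_of_nonneg_right (le_max_left _ _) hNpos.le
  -- the estimate on each residue class
  have hclass : ∀ r : ℕ,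
      ‖∑ n ∈ (Ioc N (2 * N)).filter (fun n : ℕ => n % q = r),
          ((μ n : ℝ) : ℂ) * ((ψ n : ℝ) : ℂ) * ((AddCircle.toCircle (-φ n) : Circle) : ℂ)‖ ≤
        (∑ n ∈ (Ioc N (2 * N)).filter (fun n : ℕ => n % q = r), (2 * Real.pi * ε * ψ n + w n)) +
          Real.sqrt (((10 * N : ℕ) : ℝ) / #H) * D :=
    fun r => norm_sum_class_le_of_three_term hN1 (10 * N) le_rfl q r H h0H hH ψ w φ hε hψ0 hψ1
      hsupp hw0 hw h3 hD0 (hD r)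
  -- `√(10N/#H) ≤ √10/√δ`
  have hHpos : (0 : ℝ) < #H := lt_of_lt_of_le (mul_pos hδ hNpos) hδH
  have hsq : Real.sqrt (((10 * N : ℕ) : ℝ) / #H) ≤ Real.sqrt 10 / Real.sqrt δ := by
    rw [← Real.sqrt_div (by norm_num : (0 : ℝ) ≤ 10)]
    apply Real.sqrt_le_sqrt
    rw [div_le_div_iff₀ hHpos hδ]
    push_cast
    nlinarith
  -- sum over the residue classes
  rw [sum_Ioc_eq_sum_mod_sum_filter hq N]
  calc ‖∑ r ∈ range q, ∑ n ∈ (Ioc N (2 * N)).filter (fun n : ℕ => n % q = r),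
          ((μ n : ℝ) : ℂ) * ((ψ n : ℝ) : ℂ) * ((AddCircle.toCircle (-φ n) : Circle) : ℂ)‖
      ≤ ∑ r ∈ range q, ‖∑ n ∈ (Ioc N (2 * N)).filter (fun n : ℕ => n % q = r),
          ((μ n : ℝ) : ℂ) * ((ψ n : ℝ) : ℂ) * ((AddCircle.toCircle (-φ n) : Circle) : ℂ)‖ :=
        norm_sum_le _ _
    _ ≤ ∑ r ∈ range q, ((∑ n ∈ (Ioc N (2 * N)).filter (fun n : ℕ => n % q = r),
          (2 * Real.pi * ε * ψ n + w n)) + Real.sqrt (((10 * N : ℕ) : ℝ) / #H) * D) :=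
        Finset.sum_le_sum fun r _ => hclass r
    _ = (∑ n ∈ Ioc N (2 * N), (2 * Real.pi * ε * ψ n + w n)) +
          q * (Real.sqrt (((10 * N : ℕ) : ℝ) / #H) * D) := by
        rw [Finset.sum_add_distrib, Finset.sum_const, card_range, nsmul_eq_mul,
          ← sum_Ioc_eq_sum_mod_sum_filter hq N]
    _ ≤ (∑ n ∈ Ioc N (2 * N), (2 * Real.pi * ε * ψ n + w n)) +
          q * (Real.sqrt 10 / Real.sqrt δ * D) := by
        have : Real.sqrt (((10 * N : ℕ) : ℝ) / #H) * D ≤ Real.sqrt 10 / Real.sqrt δ * D :=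
          mul_le_mul_of_nonneg_right hsq hD0
        have hq0 : (0 : ℝ) ≤ q := Nat.cast_nonneg _
        nlinarith
    _ = Real.sqrt 10 * max C₀ 0 * q / Real.sqrt δ * N / Real.log N ^ A +
          2 * Real.pi * ε * ∑ n ∈ Ioc N (2 * N), ψ n + ∑ n ∈ Ioc N (2 * N), w n := by
        rw [Finset.sum_add_distrib, ← Finset.mul_sum, hDdef]
        ring

end Summit.Parity.GeneralizedHardyLittlewood.GreenTaoLevelTwoMNTwoAlmostLinearThreeTermSum
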